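import Literature.NumberTheory.EllipticCurves.Sprung2017.SharpFlatPAdicLFunction
import Literature.NumberTheory.EllipticCurves.QuadraticTwist
import Literature.NumberTheory.EllipticCurves.Rank1Residual.Typed.Basic
import Literature.NumberTheory.EllipticCurves.LeadingTerm
import Literature.NumberTheory.EllipticCurves.Isogeny
import HarnessLib

/-!
# Cell `bsd-f1-sign2` (`p = 2`, non-CM) — analytic lens (seat `-an`), candidates AN-1 / AN-2: the ♯-VALUE AT
# THE ORDER-2 CHARACTER `χ₈` of a curve good supersingular at `2` carries `BSD₂` of its ADDITIVE `χ₈`-twist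
# (`SharpValueAtChi8` value law, `TwistPeriodAtTwoSS`, `SharpValueAtChi8ValSS`, `SharpChi8Bookkeeping`,
# leaf slice `AdditiveSharpChi8AtTwo`, door `SharpChi8DoorR`)

HONEST FRAMING (typer seat `bsd-f1-sign2-ty`; HOME `run/shared/lean/pub/bsd-f1-sign2/`, CANDIDATES.md §2
rows AN-1 / AN-2): STATEMENTS ONLY — six `@[conjecture] def`s (OPEN obligations of ours: AN-1
`SharpValueAtChi8` THEOREM-GRADE / IN-PRINT-ASSEMBLY (REF2), supports `TwistPeriodAtTwoSS`,
`SharpValueAtChi8ValSS`, the conjecture-grade bookkeeping `SharpChi8Bookkeeping`, the leaf slice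
`AdditiveSharpChi8AtTwo` (sub-crux of `ByReductionTypeAtTwo.AdditiveRankZeroAtTwo`, 8 X5 classes) and the
door `SharpChi8DoorR` (expected provable glue)); nothing asserted, nothing booked, no named fact,
PARTITION: none moved. Source: `HOME/MEMO-an-data/Sketch.lean` v2 sha16 59844b141506c32a (planner
bsd-f1-sign2-an g1, rc 0; v1 03af99e2b54e3290 audited REF1-AUDIT-v1 §2), bodies re-filed VERBATIM (namespace
moved from the sketch's `…BirchSwinnertonDyer.F1Sign2An` to the cell's `…Rank1Residual.F1Sign2`). REFUTER
PASS: REF1 §2 on v1 — `SharpValueAtChi8` SURVIVES (support, theorem-grade); v1 `TwistPeriodAtTwo` /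
`SharpValueAtChi8Val` KILLED as typed (ordinary `W` included: `Ω(W)/(√2·Ω(W₂)) = 2` on 2 105/2 105 ordinary
pairs, witness 15a1 → 960g3) and REPAIRED here as `…SS` with antecedent `GoodSS W 2` (REF1's prescription);
`SharpChi8Bookkeeping` SURVIVES (slice-restatement); door NARROW → re-typed with the leaf binders `hGZK`,
`hmod` (`SharpChi8DoorR`). REF2 v2 §0: AN-1 IN-PRINT-ASSEMBLY (KO 2006 p. 6 `ψ₁(θ_{ℚ₁}) = 2√2·L(E,χ₈,1)/Ω_E`
+ tree `ratTwistedSymbolSum_mul_plusPeriod_holds`); AN-2 OPEN (slice of leaf 19098), the ♯-value reading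
NOVEL-AS-STATED, door EMPTY on the KO unit locus (KO Cor. 1.2: there `L(E^{χ₈},1) = 0`, so
`W₂.analyticRank = 0` already places `W` off it). REF1-AUDIT-v1.md §8.2 (batch 2, 2026-08-27T15:06Z, file sha16 e1bf27aeee759c96): every v2 decl of this file **SURVIVES** (11/11 -an v2 closed Props A1 rc 0, BC7 LIBRARY-SEARCH-ON CLEAN; typing suggestions non-blocking, recorded in CANDIDATES.md §2). REF2 on the v2 rows: pending at filing.

CONVENTIONS: `θ₁ = mazurTateElement f 2 1 ∈ ℚ[X]` is the Mazur–Tate element of level `8 = 2^{1+2}` (tree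
convention `Γ = 1 + 4ℤ₂`, `γ = 5 ↔ 1 + X`), so `θ₁.eval (-2) = ∑_{a ∈ (ℤ/8)^×} χ₈(a) [a/8]⁺_f =
2([1/8]⁺ − [3/8]⁺)` is its value at the quadratic character `χ₈` of `Gal(ℚ(μ_8)/ℚ)/⟨σ_{-1}⟩` (`γ ↦ -1`),
and `θ₁ ≡ −L♯ (mod ω₁)` (`IsSprungPair`, level-1 clause) gives `θ₁.eval (-2) = −L♯(ζ₂ − 1)`.

BC5 WITNESS: AN-1 22/22 exact rows + 614/614 `v₂` rows (chi8_join.json 941eb225e1a5ad1f,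
chi8_join_sf2.json 242ca4784d91b507) and CONFIRMED OUT OF SAMPLE 8/8 on ENGINE D2 (D2-RESULT-v1 §5 →
MEMO-an-data/dan_d2_join.json: `|θ₁⁺(χ₈)| = 64, 64, 64, 128, 128, 256, 128, 32` on 6003b1, 4719m1, 5457a1,
6723c1, 4165l1, 5425f1, 7205g1, 7811d1 exactly as pre-registered; `v₂θ − v₂q = 1` on 8/8 = AN-2's
bookkeeping); `TwistPeriodAtTwoSS` 1 297/1 297 ss pairs (REF1 scan, N < 2 500). Habitat of AN-2′: 8 X5
classes (partners `a₂′ ∈ {0: 1, 2: 3, −2: 4}`). CHEAPEST FALSIFIER: one of the 8 with `v₂θ₁(W′)(χ₈)` off the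
prediction → 0/8 (NOT KILLED). WHY NOVEL: MEMO-an §AN-2 — no print computes `BSD₂` of `χ₈`-twists of
non-CM good-ss-at-2 curves (Kriz–Li exclude even `d`; CLTZ/Kezuka/Cai–Li–Zhai are CM or rational
2-torsion), REF2 MAP §5.

References: [KuriharaOtsuki2006] p. 6; [MazurTateTeitelbaum1986Invent] §I.8 (8.6) (Birch's lemma);
[Pal2012] Prop. 2.5 (period of a twist); HOME MEMO-an.md v1.2, MEMO-an-data/Sketch.lean 59844b141506c32a,
REF1-AUDIT-v1.md §2, REF2-PLACEMENT-v2.md §§0, 3.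
-/

set_option autoImplicit false

noncomputable section

open scoped Classical MatrixGroups ModularForm

open CongruenceSubgroup Polynomial WeierstrassCurve Literature.NumberTheory.EllipticCurves
  Literature.NumberTheory.EllipticCurves.ModularForms Literature.NumberTheory.EllipticCurves.Sprung2017
  Literature.NumberTheory.EllipticCurves.Rank1Residual

namespace Summit.BirchSwinnertonDyer.Rank1Residual.F1Sign2

/-- **AN-1 `SharpValueAtChi8` (value law, THEOREM-GRADE; REF1: SURVIVES as support; REF2:
IN-PRINT-ASSEMBLY): the level-1 Mazur–Tate element of a curve good at `2`, evaluated at the character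
`χ₈`, is twice the algebraic central value of its (additive at `2`) quadratic twist by `2`**:
`θ₁(W)(χ₈) · Ω(W₂) = 2 · L(W₂, 1)` for a globally minimal model `W₂` of `W ⊗ χ₈` — typed with the
period pin `ϖ·Ω(W) = Ω⁺_f` as `θ₁.eval(−2)·ϖ·Ω(W) = √8·Λ(W₂,1)` (Birch's lemma
`∑ χ(a)[a/m]⁺ = τ(χ) L(f, χ̄, 1)/Ω⁺` with `τ(χ₈) = √8`, and Pal's period formula `Ω(E^d) = ũ Ω(E)/√d`,
`ũ = 1` for `d = 2`, `2 ∤ N`). Witness 22/22 + 614/614 + 8/8 out of sample.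
[cite: KuriharaOtsuki2006, p. 6 (ψ₁(θ_{ℚ₁}) = 2√2·L(E,χ₈,1)/Ω_E)] [cite: MazurTateTeitelbaum1986Invent, §I.8 (8.6)] -/
@[conjecture] def SharpValueAtChi8 : Prop :=
  ∀ {N : ℕ} [NeZero N] (f : CuspForm (Gamma0 N) 2) (W : WeierstrassCurve ℚ) [W.IsElliptic] [W.IsGloballyMinimal]
    (W₂ : WeierstrassCurve ℚ) [W₂.IsElliptic] [W₂.IsGloballyMinimal] (ϖ : ℚ),
    IsNewformOf W f → W.HasGoodReductionAtPrime 2 →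
    (ϖ : ℝ) * W.realPeriodRat = plusPeriod f →
    (∃ C : WeierstrassCurve.VariableChange ℚ, C • W.quadraticTwist 2 = W₂) →
    (((mazurTateElement f 2 1).eval (-2) * ϖ : ℚ) : ℂ) * (W.realPeriodRat : ℂ) =
      (Real.sqrt 8 : ℂ) * W₂.entireLFunction 1

/-- **AN-1p `TwistPeriodAtTwoSS` (support; REPAIRED per REF1 §2** — the v1 form over
`HasGoodReductionAtPrime 2` is FALSE on ordinary `W`: `Ω(W)/(√2·Ω(W₂)) = 2` on 2 105/2 105 ordinary pairs,
witness 15a1 → 960g3): on a curve good SUPERSINGULAR at `2` (`a₁` even ⇒ the naive twist model is minimal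
at `2`), `√2 · Ω(W₂) = Ω(W)`. Census: 1 297/1 297 ss pairs (REF1 scan, N < 2 500) + 636 rows implied by
AN-1 data. Support-grade (Tate's algorithm at `2` + Pal 2012 Prop. 2.5). [cite: Pal2012, Prop. 2.5 (period of a quadratic twist; the 2-minimality bookkeeping is ours)] -/
@[conjecture] def TwistPeriodAtTwoSS : Prop :=
  ∀ (W : WeierstrassCurve ℚ) [W.IsElliptic] [W.IsGloballyMinimal]
    (W₂ : WeierstrassCurve ℚ) [W₂.IsElliptic] [W₂.IsGloballyMinimal],
    GoodSS W 2 →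
    (∃ C : WeierstrassCurve.VariableChange ℚ, C • W.quadraticTwist 2 = W₂) →
    Real.sqrt 2 * W₂.realPeriodRat = W.realPeriodRat

/-- **AN-1v `SharpValueAtChi8ValSS` (support; REPAIRED per REF1 §2, same defect as AN-1p):** with
`L(W₂,1) = q · Ω(W₂)`, `v₂(θ₁(W)(χ₈)·ϖ) = 1 + v₂(q)` for `W` good supersingular at `2` (614/614 + 22/22
rows). Support-grade (AN-1 + AN-1p). [folklore] -/
@[conjecture] def SharpValueAtChi8ValSS : Prop :=
  ∀ {N : ℕ} [NeZero N] (f : CuspForm (Gamma0 N) 2) (W : WeierstrassCurve ℚ) [W.IsElliptic] [W.IsGloballyMinimal]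
    (W₂ : WeierstrassCurve ℚ) [W₂.IsElliptic] [W₂.IsGloballyMinimal] (ϖ q : ℚ),
    IsNewformOf W f → GoodSS W 2 →
    (ϖ : ℝ) * W.realPeriodRat = plusPeriod f →
    (∃ C : WeierstrassCurve.VariableChange ℚ, C • W.quadraticTwist 2 = W₂) →
    W₂.entireLFunction 1 = (q : ℂ) * (W₂.realPeriodRat : ℂ) → q ≠ 0 →
    padicValRat 2 ((mazurTateElement f 2 1).eval (-2) * ϖ) = 1 + padicValRat 2 q

/-- **AN-2 `SharpChi8Bookkeeping` (the F1 candidate of the lens, conjecture-grade hypothesis = "♯-main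
conjecture + ♯-control at `χ₈`" collapsed to numbers; REF1: SURVIVES (slice-restatement); REF2: OPEN, the
♯-value reading NOVEL-AS-STATED): ♯-bookkeeping at `χ₈`.** For `W` good supersingular at `2`, non-CM, with
newform `f` and `W₂` a globally minimal model of `W ⊗ χ₈` of analytic rank `0`: `Ш(W₂)[2^∞]` is finite and
`v₂(θ₁(W)(χ₈)·ϖ) = 1 + v₂ #Ш(W₂)[2^∞] + v₂ Tam(W₂) − 2 v₂ #W₂(ℚ)_tors` (equivalently
`v₂ L♯(W)(ζ₂ − 1) = …` for every Sprung pair of `f` at `2`). The signed object carrying `BSD₂` of the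
ADDITIVE curve `W₂` is the ♯-function of the GOOD curve `W` at the order-2 character (parity switch:
layer 0 ↔ ♭, layer 1 ↔ ♯). Witness: `v₂θ − v₂q = 1` on 8/8 pre-registered classes. [folklore] -/
@[conjecture] def SharpChi8Bookkeeping : Prop :=
  ∀ {N : ℕ} [NeZero N] (f : CuspForm (Gamma0 N) 2) (W : WeierstrassCurve ℚ) [W.IsElliptic] [W.IsGloballyMinimal]
    (W₂ : WeierstrassCurve ℚ) [W₂.IsElliptic] [W₂.IsGloballyMinimal] (ϖ : ℚ),
    IsNewformOf W f → GoodSS W 2 → ¬ W.HasCM →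
    (ϖ : ℝ) * W.realPeriodRat = plusPeriod f →
    (∃ C : WeierstrassCurve.VariableChange ℚ, C • W.quadraticTwist 2 = W₂) →
    W₂.analyticRank = 0 →
    Finite (AddCommGroup.primaryComponent W₂.sha 2) ∧
      padicValRat 2 ((mazurTateElement f 2 1).eval (-2) * ϖ) =
        1 + (padicValNat 2 (Nat.card (AddCommGroup.primaryComponent W₂.sha 2)) : ℤ) +
          (padicValNat 2 W₂.tamagawaProduct : ℤ) - 2 * (padicValNat 2 W₂.torsionOrder : ℤ)

/-- **AN-2′ `AdditiveSharpChi8AtTwo` (the sub-crux of `ByReductionTypeAtTwo.AdditiveRankZeroAtTwo` this lens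
attacks; REF2: OPEN slice of leaf 19098):** `BSD(W₂, 2)` for the non-CM analytic-rank-0 curves additive at
`2` that are the `χ₈`-twist of a curve good supersingular at `2` (X5 census: 8 classes, partners
`a₂′ ∈ {0: 1, 2: 3, −2: 4}`). [folklore] -/
@[conjecture] def AdditiveSharpChi8AtTwo : Prop :=
  ∀ (W₂ : WeierstrassCurve ℚ) [W₂.IsElliptic] [W₂.IsGloballyMinimal],
    ¬ W₂.HasCM → W₂.analyticRank = 0 → Addv W₂ 2 →
    (∃ (W : WeierstrassCurve ℚ) (_ : W.IsElliptic) (_ : W.IsGloballyMinimal)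
        (C : WeierstrassCurve.VariableChange ℚ), GoodSS W 2 ∧ C • W.quadraticTwist 2 = W₂) →
    BSDp W₂ 2

/-- **AN-2″ `SharpChi8DoorR` (door, REPAIRED per REF1 §2 NARROW:** (a) the period antecedent is now the
`GoodSS` form; (b) `BSDp W₂ 2` has a RANK clause, so the leaf binders
`hGZK : rank_eq_analyticRank_of_analyticRank_le_one` and `hmod : hasEntireLFunction_rat` are carried
exactly as in `ByReductionTypeAtTwoAdditiveDescentK`). REF2 habitat note (KO 2006 Cor. 1.2): on the KO unit
locus of `W` (`2 ∤ L(W,1)/Ω`, `2 ∤ Tam`) one has `L(W ⊗ χ₈, 1) = 0`, so `W₂.analyticRank = 0` already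
places `W` off that locus (`N(W) ≡ ±1 (8)` or `2 ∣ L/Ω·Tam`); no extra binder is needed. Expected PROVABLE
glue; not a candidate. [folklore] -/
@[conjecture] def SharpChi8DoorR : Prop :=
  SharpValueAtChi8 → TwistPeriodAtTwoSS → SharpChi8Bookkeeping →
    rank_eq_analyticRank_of_analyticRank_le_one → WeierstrassCurve.hasEntireLFunction_rat →
    AdditiveSharpChi8AtTwo

end Summit.BirchSwinnertonDyer.Rank1Residual.F1Sign2

end
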